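import Mathlib
import HarnessLib
import Summits.NavierStokesRegularity.NavierStokesRegularity.Theorems.TaylorModelRungThreeCertificateIntervalDJetsArray
import Summits.NavierStokesRegularity.NavierStokesRegularity.Theorems.TaylorModelRungThreeCertificateIntervalDJetsDiff

/-!
# Crux K1b-DR (stmt-NavierStokesRegularity-23954), line `taylor-model` — certificate SOUNDNESS tooling: INTERVAL JETS, part 4 —
# ARRAY-MATERIALISED variational jets (`varJetLevelsA`, the (V1) `JV`) and jet differences (`diffJetLevelsA`, the (D1) `JD`)

Parts 1/3 proved abstractly that families of boxes closed under the rounded interval evaluation of the VARIATIONAL recursion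
(`IsVarJetEnclosure`) and of the jet-DIFFERENCE recursion (`IsDiffJetEnclosure`) along a state jet enclosure `J` enclose S1's
variational jets `U y v k` and the jet differences `T y' k − T y k`. This part materialises both as bottom-up tables over the
coordinates `c < n` (part 2's `buildLevels`), reading the state levels from a table `Ls` (normally `jetLevelsA n QBA prec Y K`):
`varStepA` forms, per `m ≤ k`, the two products `QBA Ls[m] Us[k-m]`, `QBA Us[k-m] Ls[m]` once and sums them per coordinate;
`diffStepA` the three products `QBA Ls[m] Ds[k-m]`, `QBA Ds[m] Ls[k-m]`, `QBA Ds[m] Ds[k-m]`. Structural lemmas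
`isVarJetEnclosure_varJetLevelsA`, `isDiffJetEnclosure_diffJetLevelsA` (no soundness hypothesis) and the enclosure theorems
`mem_varJet_of_varJetLevelsA` (direction `v` in the box `D`) and `mem_diffJet_of_diffJetLevelsA` (displacement `rd y' − rd y` in
the box `D`, field additive in each slot, reader additive) over the state levels `jetLevelsA n QBA prec Y K` of a base point `y`
with coordinates in `Y`.

MODEL-lattice bookkeeping only (rung TL-M3, one finite-dimensional model ODE); nothing here concerns the Navier–Stokes equations.
-/

-- the sub-problem namespace repeats the summit name by design (D-0017)
set_option linter.dupNamespace false

namespace Summit.NavierStokesRegularity.NavierStokesRegularity.Theorems.TaylorModelCert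

open scoped BigOperators

namespace IntervalD

/-! ### Variational levels -/

/-- The VARIATIONAL STEP on arrays: level `k+1` of the variation table `Us` along the state table `Ls` — the `2(k+1)` products
are formed once, then summed per coordinate `c < n` and divided by `k+1` with outward rounding. [folklore] -/
def varStepA (n : ℕ) (QBA : Array IntervalD → Array IntervalD → Array IntervalD) (prec : ℕ) (Ls : Array (Array IntervalD))
    (k : ℕ) (Us : Array (Array IntervalD)) : Array IntervalD :=
  let prods : Array (Array IntervalD) := Array.ofFn fun m : Fin (k + 1) =>
    let P := QBA (lget Ls m) (lget Us (k - m))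
    let P' := QBA (lget Us (k - m)) (lget Ls m)
    Array.ofFn fun c : Fin n => addR prec (aget P c) (aget P' c)
  Array.ofFn fun c : Fin n => divNat prec (rangeSumR prec (fun m => aget (lget prods m) c) (k + 1)) (k + 1)

/-- **Variational interval jets, materialised**: the table of the levels `0..K` over the direction box `D` along the state table
`Ls`. [folklore] -/
def varJetLevelsA (n : ℕ) (QBA : Array IntervalD → Array IntervalD → Array IntervalD) (prec : ℕ) (Ls : Array (Array IntervalD))
    (D : Array IntervalD) : ℕ → Array (Array IntervalD) :=
  buildLevels (varStepA n QBA prec Ls) D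

/-- Variational-step outputs have size `n`. [folklore] -/
theorem size_varStepA (n : ℕ) (QBA : Array IntervalD → Array IntervalD → Array IntervalD) (prec : ℕ) (Ls : Array (Array IntervalD))
    (k : ℕ) (Us : Array (Array IntervalD)) : (varStepA n QBA prec Ls k Us).size = n := by
  simp only [varStepA, Array.size_ofFn]

/-- **The materialised variational levels form a variational jet enclosure** along the state table (structural). [folklore] -/
theorem isVarJetEnclosure_varJetLevelsA (n : ℕ) (QBA : Array IntervalD → Array IntervalD → Array IntervalD) (prec K : ℕ)
    {Ls : Array (Array IntervalD)} (hLs : ∀ m ≤ K, (lget Ls m).size = n) {D : Array IntervalD} (hD : D.size = n) :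
    IsVarJetEnclosure (fnField n QBA) prec K (fnLevels n Ls) (fnLevels n (varJetLevelsA n QBA prec Ls D K)) := by
  intro k hk c x hx
  have hsz : ∀ {j : ℕ}, j ≤ K → (lget (buildLevels (varStepA n QBA prec Ls) D K) j).size = n := fun hj =>
    size_lget_buildLevels _ D hD (size_varStepA n QBA prec Ls) hj
  have hlev : aget (lget (varJetLevelsA n QBA prec Ls D K) (k + 1)) c =
      varJetStep (fnField n QBA) prec (fnLevels n Ls) (fnLevels n (varJetLevelsA n QBA prec Ls D K)) k c := by
    simp only [varJetStep, fnField]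
    unfold varJetLevelsA
    rw [lget_buildLevels_of_le _ D (Nat.succ_le_of_lt hk), lget_buildLevels_succ]
    simp only [varStepA]
    rw [aget_ofFn _ c.isLt]
    congr 1
    refine rangeSumR_congr prec (k + 1) fun m hm => ?_
    have hm' : m ≤ K := by omega
    have hkm : k - m ≤ K := by omega
    have e2 : lget (buildLevels (varStepA n QBA prec Ls) D k) (k - m) = lget (buildLevels (varStepA n QBA prec Ls) D K) (k - m) := by
      rw [lget_buildLevels_of_le _ D hkm, lget_buildLevels_of_le _ D (Nat.sub_le k m)]
    rw [lget_ofFn _ hm]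
    dsimp only
    rw [aget_ofFn _ c.isLt, e2, ofFn_fnLevels (hLs m hm'), ofFn_fnLevels (hsz hkm)]
  show mem x (aget (lget (varJetLevelsA n QBA prec Ls D K) (k + 1)) c)
  rw [hlev]; exact hx

section SoundVar

variable {V : Type*} {rd : V → ℕ → ℝ} {Q : V → V → V} {n : ℕ}

/-- **The materialised variational jets enclose S1's variational jets** `U y v k` for base points `y` with coordinates in `Y` and
directions `v` with coordinates in `D`, along the state levels `jetLevelsA n QBA prec Y K`. [folklore] -/
theorem mem_varJet_of_varJetLevelsA {T : V → ℕ → V} {U : V → V → ℕ → V} (hT0 : ∀ x, ∀ c < n, rd (T x 0) c = rd x c)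
    (hTs : ∀ x (k : ℕ), ∀ c < n, ((k : ℝ) + 1) * rd (T x (k + 1)) c =
      ∑ i ∈ Finset.range (k + 1), rd (Q (T x i) (T x (k - i))) c)
    (hU0 : ∀ x v, ∀ c < n, rd (U x v 0) c = rd v c)
    (hUs : ∀ x v (k : ℕ), ∀ c < n, ((k : ℝ) + 1) * rd (U x v (k + 1)) c =
      ∑ i ∈ Finset.range (k + 1), (rd (Q (T x i) (U x v (k - i))) c + rd (Q (U x v (k - i)) (T x i)) c))
    {QBA : Array IntervalD → Array IntervalD → Array IntervalD} (hQBA : IsFieldEnclosureA rd Q n QBA)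
    (prec K : ℕ) {Y D : Array IntervalD} (hY : Y.size = n) (hD : D.size = n) {y v : V}
    (hy : ∀ c < n, mem (rd y c) (aget Y c)) (hv : ∀ c < n, mem (rd v c) (aget D c)) :
    ∀ k ≤ K, ∀ c < n, mem (rd (U y v k) c)
      (aget (lget (varJetLevelsA n QBA prec (jetLevelsA n QBA prec Y K) D K) k) c) := by
  have hy' : ∀ c : Fin n, mem (rd y c) (fnLevels n (jetLevelsA n QBA prec Y K) 0 c) := fun c => by
    simp only [fnLevels]; rw [lget_jetLevelsA_zero]; exact hy c c.isLt
  have hv' : ∀ c : Fin n, mem (rd v c) (fnLevels n (varJetLevelsA n QBA prec (jetLevelsA n QBA prec Y K) D K) 0 c) := fun c => by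
    simp only [fnLevels]; unfold varJetLevelsA; rw [lget_buildLevels_zero]; exact hv c c.isLt
  intro k hk c hc
  exact mem_varJet_of_isVarJetEnclosure (rd := fun (x : V) (c : Fin n) => rd x c) (Q := Q) (T := T) (U := U)
    (fun x c => hT0 x c c.isLt) (fun x k c => hTs x k c c.isLt) (fun x v c => hU0 x v c c.isLt)
    (fun x v k c => hUs x v k c c.isLt) (isFieldEnclosure_fnField hQBA) (isJetEnclosure_jetLevelsA QBA prec K hY)
    (isVarJetEnclosure_varJetLevelsA n QBA prec K (fun m hm => size_lget_jetLevelsA n QBA prec hY hm) hD) hy' hv' k hk ⟨c, hc⟩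

end SoundVar

/-! ### Difference levels -/

/-- The DIFFERENCE STEP on arrays: level `k+1` of the difference table `Ds` along the state table `Ls` — the `3(k+1)` products
are formed once, then summed per coordinate `c < n` and divided by `k+1` with outward rounding. [folklore] -/
def diffStepA (n : ℕ) (QBA : Array IntervalD → Array IntervalD → Array IntervalD) (prec : ℕ) (Ls : Array (Array IntervalD))
    (k : ℕ) (Ds : Array (Array IntervalD)) : Array IntervalD :=
  let prods : Array (Array IntervalD) := Array.ofFn fun m : Fin (k + 1) =>
    let P₁ := QBA (lget Ls m) (lget Ds (k - m))
    let P₂ := QBA (lget Ds m) (lget Ls (k - m))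
    let P₃ := QBA (lget Ds m) (lget Ds (k - m))
    Array.ofFn fun c : Fin n => addR prec (addR prec (aget P₁ c) (aget P₂ c)) (aget P₃ c)
  Array.ofFn fun c : Fin n => divNat prec (rangeSumR prec (fun m => aget (lget prods m) c) (k + 1)) (k + 1)

/-- **Jet-difference interval enclosures, materialised**: the table of the levels `0..K` over the difference box `D` along the
state table `Ls`. [folklore] -/
def diffJetLevelsA (n : ℕ) (QBA : Array IntervalD → Array IntervalD → Array IntervalD) (prec : ℕ) (Ls : Array (Array IntervalD))
    (D : Array IntervalD) : ℕ → Array (Array IntervalD) :=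
  buildLevels (diffStepA n QBA prec Ls) D

/-- Difference-step outputs have size `n`. [folklore] -/
theorem size_diffStepA (n : ℕ) (QBA : Array IntervalD → Array IntervalD → Array IntervalD) (prec : ℕ)
    (Ls : Array (Array IntervalD)) (k : ℕ) (Ds : Array (Array IntervalD)) : (diffStepA n QBA prec Ls k Ds).size = n := by
  simp only [diffStepA, Array.size_ofFn]

/-- **The materialised difference levels form a jet-difference enclosure** along the state table (structural). [folklore] -/
theorem isDiffJetEnclosure_diffJetLevelsA (n : ℕ) (QBA : Array IntervalD → Array IntervalD → Array IntervalD) (prec K : ℕ)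
    {Ls : Array (Array IntervalD)} (hLs : ∀ m ≤ K, (lget Ls m).size = n) {D : Array IntervalD} (hD : D.size = n) :
    IsDiffJetEnclosure (fnField n QBA) prec K (fnLevels n Ls) (fnLevels n (diffJetLevelsA n QBA prec Ls D K)) := by
  intro k hk c x hx
  have hsz : ∀ {j : ℕ}, j ≤ K → (lget (buildLevels (diffStepA n QBA prec Ls) D K) j).size = n := fun hj =>
    size_lget_buildLevels _ D hD (size_diffStepA n QBA prec Ls) hj
  have hlev : aget (lget (diffJetLevelsA n QBA prec Ls D K) (k + 1)) c =
      diffJetStep (fnField n QBA) prec (fnLevels n Ls) (fnLevels n (diffJetLevelsA n QBA prec Ls D K)) k c := by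
    simp only [diffJetStep, fnField]
    unfold diffJetLevelsA
    rw [lget_buildLevels_of_le _ D (Nat.succ_le_of_lt hk), lget_buildLevels_succ]
    simp only [diffStepA]
    rw [aget_ofFn _ c.isLt]
    congr 1
    refine rangeSumR_congr prec (k + 1) fun m hm => ?_
    have hm' : m ≤ K := by omega
    have hkm : k - m ≤ K := by omega
    have e1 : lget (buildLevels (diffStepA n QBA prec Ls) D k) m = lget (buildLevels (diffStepA n QBA prec Ls) D K) m := by
      rw [lget_buildLevels_of_le _ D hm', lget_buildLevels_of_le _ D (Nat.le_of_lt_succ hm)]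
    have e2 : lget (buildLevels (diffStepA n QBA prec Ls) D k) (k - m) = lget (buildLevels (diffStepA n QBA prec Ls) D K) (k - m) := by
      rw [lget_buildLevels_of_le _ D hkm, lget_buildLevels_of_le _ D (Nat.sub_le k m)]
    rw [lget_ofFn _ hm]
    dsimp only
    rw [aget_ofFn _ c.isLt, e1, e2, ofFn_fnLevels (hLs m hm'), ofFn_fnLevels (hLs (k - m) hkm), ofFn_fnLevels (hsz hm'),
      ofFn_fnLevels (hsz hkm)]
  show mem x (aget (lget (diffJetLevelsA n QBA prec Ls D K) (k + 1)) c)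
  rw [hlev]; exact hx

section SoundDiff

variable {V : Type*} [AddCommGroup V] {rd : V → ℕ → ℝ} {Q : V → V → V} {n : ℕ}

/-- **The materialised difference levels enclose the jet differences** `rd (T y' k) c − rd (T y k) c` for base points `y` with
coordinates in `Y` and displacements `rd y' − rd y` with coordinates in `D`, along the state levels of `y`; `Q` additive in each slot,
`rd` additive. [folklore] -/
theorem mem_diffJet_of_diffJetLevelsA {T : V → ℕ → V} (hQl : ∀ a d b, Q (a + d) b = Q a b + Q d b)
    (hQr : ∀ a b e, Q a (b + e) = Q a b + Q a e) (hrd : ∀ x z, ∀ c < n, rd (x + z) c = rd x c + rd z c)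
    (hT0 : ∀ x, ∀ c < n, rd (T x 0) c = rd x c)
    (hTs : ∀ x (k : ℕ), ∀ c < n, ((k : ℝ) + 1) * rd (T x (k + 1)) c =
      ∑ i ∈ Finset.range (k + 1), rd (Q (T x i) (T x (k - i))) c)
    {QBA : Array IntervalD → Array IntervalD → Array IntervalD} (hQBA : IsFieldEnclosureA rd Q n QBA)
    (prec K : ℕ) {Y D : Array IntervalD} (hY : Y.size = n) (hD : D.size = n) {y y' : V}
    (hy : ∀ c < n, mem (rd y c) (aget Y c)) (hd : ∀ c < n, mem (rd y' c - rd y c) (aget D c)) :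
    ∀ k ≤ K, ∀ c < n, mem (rd (T y' k) c - rd (T y k) c)
      (aget (lget (diffJetLevelsA n QBA prec (jetLevelsA n QBA prec Y K) D K) k) c) := by
  have hy' : ∀ c : Fin n, mem (rd y c) (fnLevels n (jetLevelsA n QBA prec Y K) 0 c) := fun c => by
    simp only [fnLevels]; rw [lget_jetLevelsA_zero]; exact hy c c.isLt
  have hd' : ∀ c : Fin n, mem (rd y' c - rd y c)
      (fnLevels n (diffJetLevelsA n QBA prec (jetLevelsA n QBA prec Y K) D K) 0 c) := fun c => by
    simp only [fnLevels]; unfold diffJetLevelsA; rw [lget_buildLevels_zero]; exact hd c c.isLt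
  intro k hk c hc
  exact mem_diffJet_of_isDiffJetEnclosure (rd := fun (x : V) (c : Fin n) => rd x c) (Q := Q) (T := T) hQl hQr
    (fun x z c => hrd x z c c.isLt) (fun x c => hT0 x c c.isLt) (fun x k c => hTs x k c c.isLt)
    (isFieldEnclosure_fnField hQBA) (isJetEnclosure_jetLevelsA QBA prec K hY)
    (isDiffJetEnclosure_diffJetLevelsA n QBA prec K (fun m hm => size_lget_jetLevelsA n QBA prec hY hm) hD) hy' hd' k hk ⟨c, hc⟩

end SoundDiff

end IntervalD

end Summit.NavierStokesRegularity.NavierStokesRegularity.Theorems.TaylorModelCert
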